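import Summits.BirchSwinnertonDyer.Rank1Residual.ManinAdditive.TwistOrbitManinNearInvariance
import Literature.NumberTheory.EllipticCurves.ManinConstantNonPotentiallyOrdinaryPrimes
import Summits.BirchSwinnertonDyer.BirchSwinnertonDyer.Theses.ManinLocalTwoThree
import HarnessLib
import HarnessLib.Audit.Tags

/-!
# §28 THE DIRECTION LAW AS A NECESSARY CONDITION OF «p ∤ c» — route edges (E-an-34) from the cruxes of the
# cell's ledger route `ManinLocalTwoThree` and from Edixhoven 1991 Thm. 3 to the leaf
# `CommutingOrbitDiscrDirection(R) p` — cell `bsd-f2-manin`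

Cell `bsd-f2-manin` (D-0131 (3) frontier: the Manin constant at additive primes), analytic lens (planner
`bsd-f2-manin-an` g5, MEMO-an §45), typed VERBATIM by the cell typer from HOME
`run/shared/lean/pub/bsd-f2-manin/an/TwistOrbitManinNearInvariance-g5.lean` sha16 442398fa4904251b, `section
RouteEdges` (lines 329–498; farm rc 0 · 0/0/0; refuter-1 §R31: E-an-34 edges PROVED-REPRODUCED, axioms standard),
with ONE adaptation announced by the planner-of-record (imc 2026-08-27T21:50:43Z) and refuter-1 (§R31 (5)): the
route's EDIT 2 (21:38:22Z) re-typed the cruxes C3 `ManinPrimeToThreeAtNine` (stmt-BirchSwinnertonDyer-22968) and C5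
`ManinPrimeToAdditiveFiveLe` (stmt-BirchSwinnertonDyer-22969) as `mazur_… → abbesUllmo_… → cesnavicius_… →
exists_isNewformOf → (fact-free body)`, so the BY-NAME edges take the support item `PrintedSemistableManinFacts`
(stmt-BirchSwinnertonDyer-22970, four conjuncts) as an extra binder and feed its conjuncts to the crux; the
fact-free lemmas are the planner's verbatim. Also added: the same two edges into the repaired leaf of record
`CommutingOrbitDiscrDirectionR` (refuter-1 §R31 C′). CONTENT: on a commuting optimal `p*`-pair with `p ∤ c` and
`p ∤ c′` the modular degree and the minimal discriminant move together (§27), whence MONOTONICITY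
`v_p c ≤ v_p c′ ≤ v_p c + 1` when `deg′ = p·deg`, the descent `p ∤ c′ ⇒ p ∤ c`, and: `CommutingOrbitDiscrDirection p`
is IMPLIED by C5 (`p ≥ 5`) resp. C3 (`p = 3`) given the printed facts — a typed KILL PATH for the route (one
commuting optimal pair with degree UP and discriminant DOWN refutes the crux; census 0 / 667 706) — and holds
outright, granted Edixhoven 1991 Thm. 3 by name (tree fact
`edixhoven_not_dvd_maninConstant_of_not_potentiallyGoodOrdinary`), at `p > 7` off the potentially-good-ordinary
locus (Edixhoven's «only case 2 occurs», §4). Nothing conjectural is asserted: cruxes, facts and the support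
bundle enter as hypotheses. No summit statement is touched; nothing here bears on the truth of BSD.
[cite: EdixhovenManin1991, Thm. 3 and §4 (pp. 12–13)]
-/

noncomputable section

open scoped MatrixGroups ModularForm

open CongruenceSubgroup WeierstrassCurve
  Literature.NumberTheory.DiophantineGeometry
  Literature.NumberTheory.EllipticCurves
  Literature.NumberTheory.EllipticCurves.ModularForms

namespace Summit.BirchSwinnertonDyer.Rank1Residual.ManinAdditive

/-! ## §28 (g5) THE DIRECTION LAW AS A NECESSARY CONDITION OF «p ∤ c» — edges to the cell's ledger route
`ManinLocalTwoThree` (C3 `ManinPrimeToThreeAtNine`, C5 `ManinPrimeToAdditiveFiveLe`) and to Edixhoven's Thm. 3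
(tree named fact): on a commuting optimal `p*`-pair with `p ∤ c` and `p ∤ c′` the modular degree and the minimal
discriminant move together (§27).  Hence `CommutingOrbitDiscrDirection p` is IMPLIED by the route's cruxes — a typed
KILL PATH: one commuting optimal pair with degree UP and discriminant DOWN refutes C5 (`p ≥ 5`) resp. C3 (`p = 3`) —
and holds outright, granted Edixhoven 1991 Thm. 3 by name, at `p > 7` off the potentially-good-ordinary locus. -/

section RouteEdges

open IsDedekindDomain NumberField

open scoped NumberField

/-- **Per pair: `p ∤ c`, `p ∤ c′` ⇒ (degree up ⟺ discriminant up)** on a commuting optimal `p*`-pair (§27). -/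
theorem pStar_optimal_commuting_discrDirection_iff_of_not_dvd {p : ℕ} (hp : p.Prime) (hp2 : p ≠ 2) :
    ∀ (W W' : WeierstrassCurve ℚ) [W.IsElliptic] [W.IsGloballyMinimal] [W'.IsElliptic]
      [W'.IsGloballyMinimal] [NeZero (W.conductorNorm ℤ)] [NeZero (W'.conductorNorm ℤ)]
      (u : VariableChange ℚ) (D : ModularParametrizationData W (W.conductorNorm ℤ))
      (D' : ModularParametrizationData W' (W'.conductorNorm ℤ)),
      IsLatticeOptimal D → IsLatticeOptimal D' →
      p ^ 2 ∣ W.conductorNorm ℤ → W'.conductorNorm ℤ = W.conductorNorm ℤ →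
      u • W.quadraticTwist ((((-1 : ℤ) ^ (p / 2) * p : ℤ)) : ℚ) = W' →
      ¬ (p : ℤ) ∣ D.maninConstant → ¬ (p : ℤ) ∣ D'.maninConstant →
      (D'.modularDegree = p * D.modularDegree ↔
        padicValInt p W'.minimalDiscriminantInt = padicValInt p W.minimalDiscriminantInt + 6) := by
  intro W W' _ _ _ _ _ _ u D D' hD hD' hM hN hu hc hc'
  haveI : Fact p.Prime := ⟨hp⟩
  have h0 : padicValInt p D.c = 0 := padicValInt.eq_zero_of_not_dvd hc
  have h0' : padicValInt p D'.c = 0 := padicValInt.eq_zero_of_not_dvd hc'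
  have hpos : 0 < D.modularDegree := D.deg_pos
  rcases pStar_optimal_commuting_manin_near_invariance hp hp2 W W' u D D' hD hD' hM hN hu with
    ⟨hdeg, h⟩ | ⟨hdeg, h⟩
  · constructor
    · intro; omega
    · intro; exact hdeg
  · have hndeg : D'.modularDegree ≠ p * D.modularDegree := by
      intro hdeg'
      have h1 : p * (p * D.modularDegree) = 1 * D.modularDegree := by rw [← hdeg', hdeg, one_mul]
      have h2 : p * p = 1 := Nat.eq_of_mul_eq_mul_right hpos (by rw [← mul_assoc] at h1; exact h1)
      exact hp.one_lt.ne' (Nat.eq_one_of_mul_eq_one_right h2)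
    constructor
    · intro h'; exact absurd h' hndeg
    · intro; omega

/-- **Manin valuations are MONOTONE IN THE MODULAR DEGREE on a commuting optimal `p*`-pair** (§27, one-sided
form): if `deg φ′ = p · deg φ` then `v_p(c) ≤ v_p(c′) ≤ v_p(c) + 1`.  Hence Manin's conjecture DESCENDS along the
degree (`p ∤ c′ ⇒ p ∤ c`) and a `p` in the lower-degree constant PROPAGATES UP (`p ∣ c ⇒ p ∣ c′`). -/
theorem pStar_optimal_commuting_padicValInt_c_monotone {p : ℕ} (hp : p.Prime) (hp2 : p ≠ 2) :
    ∀ (W W' : WeierstrassCurve ℚ) [W.IsElliptic] [W.IsGloballyMinimal] [W'.IsElliptic]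
      [W'.IsGloballyMinimal] [NeZero (W.conductorNorm ℤ)] [NeZero (W'.conductorNorm ℤ)]
      (u : VariableChange ℚ) (D : ModularParametrizationData W (W.conductorNorm ℤ))
      (D' : ModularParametrizationData W' (W'.conductorNorm ℤ)),
      IsLatticeOptimal D → IsLatticeOptimal D' →
      p ^ 2 ∣ W.conductorNorm ℤ → W'.conductorNorm ℤ = W.conductorNorm ℤ →
      u • W.quadraticTwist ((((-1 : ℤ) ^ (p / 2) * p : ℤ)) : ℚ) = W' →
      D'.modularDegree = p * D.modularDegree →
      padicValInt p D.c ≤ padicValInt p D'.c ∧ padicValInt p D'.c ≤ padicValInt p D.c + 1 := by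
  intro W W' _ _ _ _ _ _ u D D' hD hD' hM hN hu hdeg
  have hpos : 0 < D.modularDegree := D.deg_pos
  rcases pStar_optimal_commuting_manin_near_invariance hp hp2 W W' u D D' hD hD' hM hN hu with
    ⟨_, h⟩ | ⟨hdeg2, _⟩
  · omega
  · exfalso
    have h1 : p * (p * D.modularDegree) = 1 * D.modularDegree := by rw [← hdeg, hdeg2, one_mul]
    have h2 : p * p = 1 := Nat.eq_of_mul_eq_mul_right hpos (by rw [← mul_assoc] at h1; exact h1)
    exact hp.one_lt.ne' (Nat.eq_one_of_mul_eq_one_right h2)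

/-- **Descent of Manin's conjecture along the degree** (contrapositive packaging of the monotonicity): on a commuting
optimal `p*`-pair with `deg φ′ = p · deg φ`, `p ∤ c′ ⇒ p ∤ c`. -/
theorem pStar_optimal_commuting_not_dvd_c_of_not_dvd_c_up {p : ℕ} (hp : p.Prime) (hp2 : p ≠ 2) :
    ∀ (W W' : WeierstrassCurve ℚ) [W.IsElliptic] [W.IsGloballyMinimal] [W'.IsElliptic]
      [W'.IsGloballyMinimal] [NeZero (W.conductorNorm ℤ)] [NeZero (W'.conductorNorm ℤ)]
      (u : VariableChange ℚ) (D : ModularParametrizationData W (W.conductorNorm ℤ))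
      (D' : ModularParametrizationData W' (W'.conductorNorm ℤ)),
      IsLatticeOptimal D → IsLatticeOptimal D' →
      p ^ 2 ∣ W.conductorNorm ℤ → W'.conductorNorm ℤ = W.conductorNorm ℤ →
      u • W.quadraticTwist ((((-1 : ℤ) ^ (p / 2) * p : ℤ)) : ℚ) = W' →
      D'.modularDegree = p * D.modularDegree →
      ¬ (p : ℤ) ∣ D'.maninConstant → ¬ (p : ℤ) ∣ D.maninConstant := by
  intro W W' _ _ _ _ _ _ u D D' hD hD' hM hN hu hdeg hc' hc
  haveI : Fact p.Prime := ⟨hp⟩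
  have h0' : padicValInt p D'.c = 0 := padicValInt.eq_zero_of_not_dvd hc'
  have hmono := pStar_optimal_commuting_padicValInt_c_monotone hp hp2 W W' u D D' hD hD' hM hN hu hdeg
  have hcne : D.c ≠ 0 := D.maninConstant_ne_zero_holds
  have hc1 : (p : ℤ) ^ 1 ∣ D.c := by rw [pow_one]; exact hc
  have h1 : 1 ≤ padicValInt p D.c := by
    rcases (padicValInt_dvd_iff 1 D.c).mp hc1 with h | h
    · exact absurd h hcne
    · exact h
  omega

/-- **C5 of the route `ManinLocalTwoThree` ⇒ the direction law at every prime `p ≥ 5`** (typed kill path: a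
commuting optimal `p*`-pair with `deg′ = p·deg` and `v_pΔ′ = v_pΔ − 6` refutes `ManinPrimeToAdditiveFiveLe`).
The hypothesis `h5` is VERBATIM the route item `Summit.BirchSwinnertonDyer.BirchSwinnertonDyer.Theses.
ManinLocalTwoThree.ManinPrimeToAdditiveFiveLe` in its FACT-FREE body (the route's EDIT-2 item stmt-BirchSwinnertonDyer-22969
prefixes the four printed facts; the by-name edge `commutingOrbitDiscrDirection_of_C5` below feeds them). -/
theorem commutingOrbitDiscrDirection_of_maninPrimeToAdditiveFiveLe
    (h5 : ∀ (W : WeierstrassCurve ℚ) [W.IsElliptic] [W.IsGloballyMinimal] {N : ℕ} [NeZero N]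
      (D : ModularParametrizationData W N),
      (∀ z ∈ D.L.lattice, ∃ w ∈ periodLattice D.f, z = D.c * w) →
      ∀ p : ℕ, p.Prime → 5 ≤ p → p ^ 2 ∣ N → ¬ (p : ℤ) ∣ D.maninConstant)
    {p : ℕ} (hp : p.Prime) (h5p : 5 ≤ p) : CommutingOrbitDiscrDirection p := by
  intro W W' _ _ _ _ _ _ u D D' hD hD' hM hN hu hdeg
  have hp2 : p ≠ 2 := by omega
  have hM' : p ^ 2 ∣ W'.conductorNorm ℤ := by rw [hN]; exact hM
  have hc : ¬ (p : ℤ) ∣ D.maninConstant := h5 W D hD p hp h5p hM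
  have hc' : ¬ (p : ℤ) ∣ D'.maninConstant := h5 W' D' hD' p hp h5p hM'
  exact (pStar_optimal_commuting_discrDirection_iff_of_not_dvd hp hp2 W W' u D D' hD hD' hM hN hu hc
    hc').mp hdeg

/-- **C3 of the route `ManinLocalTwoThree` ⇒ the direction law at `p = 3`** (typed kill path at 3; `h3` is
the FACT-FREE body of the route item `…Theses.ManinLocalTwoThree.ManinPrimeToThreeAtNine`, EDIT-2 id stmt-BirchSwinnertonDyer-22968;
by-name edge `commutingOrbitDiscrDirection_three_of_C3` below). -/
theorem commutingOrbitDiscrDirection_three_of_maninPrimeToThreeAtNine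
    (h3 : ∀ (W : WeierstrassCurve ℚ) [W.IsElliptic] [W.IsGloballyMinimal] {N : ℕ} [NeZero N]
      (D : ModularParametrizationData W N),
      (∀ z ∈ D.L.lattice, ∃ w ∈ periodLattice D.f, z = D.c * w) →
      3 ^ 2 ∣ N → ¬ (3 : ℤ) ∣ D.maninConstant) :
    CommutingOrbitDiscrDirection 3 := by
  intro W W' _ _ _ _ _ _ u D D' hD hD' hM hN hu hdeg
  have hM' : 3 ^ 2 ∣ W'.conductorNorm ℤ := by rw [hN]; exact hM
  have hc : ¬ ((3 : ℕ) : ℤ) ∣ D.maninConstant := by exact_mod_cast h3 W D hD hM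
  have hc' : ¬ ((3 : ℕ) : ℤ) ∣ D'.maninConstant := by exact_mod_cast h3 W' D' hD' hM'
  exact (pStar_optimal_commuting_discrDirection_iff_of_not_dvd Nat.prime_three (by norm_num) W W' u D
    D' hD hD' hM hN hu hc hc').mp hdeg

/-- **Granted Edixhoven 1991 Thm. 3 by name (tree fact, first sentence): the direction law holds at every
`p > 7` on commuting optimal pairs OFF the potentially-good-ordinary locus** (both members outside the fact's
(G)-ordinary shape) — Edixhoven's «only case 2 occurs» [§4, last paragraph] derived from his Thm. 3 + §27.
[cite: EdixhovenManin1991, Thm. 3 and §4] -/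
theorem pStar_optimal_commuting_discrDirection_of_edixhoven
    (hE : edixhoven_not_dvd_maninConstant_of_not_potentiallyGoodOrdinary) {p : ℕ} (hp : p.Prime)
    (h7 : 7 < p) :
    ∀ (W W' : WeierstrassCurve ℚ) [W.IsElliptic] [W.IsGloballyMinimal] [W'.IsElliptic]
      [W'.IsGloballyMinimal] [NeZero (W.conductorNorm ℤ)] [NeZero (W'.conductorNorm ℤ)]
      (u : VariableChange ℚ) (D : ModularParametrizationData W (W.conductorNorm ℤ))
      (D' : ModularParametrizationData W' (W'.conductorNorm ℤ)),
      IsLatticeOptimal D → IsLatticeOptimal D' →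
      p ^ 2 ∣ W.conductorNorm ℤ → W'.conductorNorm ℤ = W.conductorNorm ℤ →
      u • W.quadraticTwist ((((-1 : ℤ) ^ (p / 2) * p : ℤ)) : ℚ) = W' →
      (¬ ∃ (L : Type) (_ : Field L) (_ : NumberField L) (_ : IsCyclotomicExtension {p} ℚ L)
          (F : IntermediateField ℚ L),
          ∀ w : HeightOneSpectrum (𝓞 F), (p : 𝓞 F) ∈ w.asIdeal →
            (W.baseChange F).HasGoodReductionAt w ∧ (W.baseChange F).HasUnitRootAt w) →
      (¬ ∃ (L : Type) (_ : Field L) (_ : NumberField L) (_ : IsCyclotomicExtension {p} ℚ L)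
          (F : IntermediateField ℚ L),
          ∀ w : HeightOneSpectrum (𝓞 F), (p : 𝓞 F) ∈ w.asIdeal →
            (W'.baseChange F).HasGoodReductionAt w ∧ (W'.baseChange F).HasUnitRootAt w) →
      (D'.modularDegree = p * D.modularDegree ↔
        padicValInt p W'.minimalDiscriminantInt = padicValInt p W.minimalDiscriminantInt + 6) := by
  intro W W' _ _ _ _ _ _ u D D' hD hD' hM hN hu hG hG'
  have hp2 : p ≠ 2 := by omega
  exact pStar_optimal_commuting_discrDirection_iff_of_not_dvd hp hp2 W W' u D D' hD hD' hM hN hu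
    (hE W D hD p hp h7 hG) (hE W' D' hD' p hp h7 hG')


/-- **Route edge BY NAME: C5 `ManinLocalTwoThree.ManinPrimeToAdditiveFiveLe` (stmt-BirchSwinnertonDyer-22969;
EDIT 2: the crux is conditioned on the four printed facts, bundled as the support item
`ManinLocalTwoThree.PrintedSemistableManinFacts`, stmt-BirchSwinnertonDyer-22970) ⇒ the direction law at every
prime `p ≥ 5`.** Typed kill path of the route: one commuting optimal `p*`-pair with `deg′ = p·deg` and
`v_pΔ′ = v_pΔ − 6` refutes C5 (given the printed facts). -/
theorem commutingOrbitDiscrDirection_of_C5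
    (hPF : Summit.BirchSwinnertonDyer.BirchSwinnertonDyer.Theses.ManinLocalTwoThree.PrintedSemistableManinFacts)
    (h5 : Summit.BirchSwinnertonDyer.BirchSwinnertonDyer.Theses.ManinLocalTwoThree.ManinPrimeToAdditiveFiveLe)
    {p : ℕ} (hp : p.Prime) (h5p : 5 ≤ p) : CommutingOrbitDiscrDirection p := by
  obtain ⟨hM, hAU, hC, hnf⟩ := hPF
  exact commutingOrbitDiscrDirection_of_maninPrimeToAdditiveFiveLe (h5 hM hAU hC hnf) hp h5p

/-- The same edge into the REPAIRED leaf of record `CommutingOrbitDiscrDirectionR` (refuter-1 §R31 C′). -/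
theorem commutingOrbitDiscrDirectionR_of_C5
    (hPF : Summit.BirchSwinnertonDyer.BirchSwinnertonDyer.Theses.ManinLocalTwoThree.PrintedSemistableManinFacts)
    (h5 : Summit.BirchSwinnertonDyer.BirchSwinnertonDyer.Theses.ManinLocalTwoThree.ManinPrimeToAdditiveFiveLe)
    {p : ℕ} (h5p : 5 ≤ p) : CommutingOrbitDiscrDirectionR p :=
  fun hp _ ↦ commutingOrbitDiscrDirection_of_C5 hPF h5 hp h5p

/-- **Route edge BY NAME: C3 `ManinLocalTwoThree.ManinPrimeToThreeAtNine` (stmt-BirchSwinnertonDyer-22968; EDIT 2,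
conditioned on `PrintedSemistableManinFacts`, stmt-BirchSwinnertonDyer-22970) ⇒ the direction law at `p = 3`.**
Typed kill path at 3: one commuting optimal `(−3)`-pair with `deg′ = 3·deg` and `v₃Δ′ = v₃Δ − 6` refutes C3
(given the printed facts). -/
theorem commutingOrbitDiscrDirection_three_of_C3
    (hPF : Summit.BirchSwinnertonDyer.BirchSwinnertonDyer.Theses.ManinLocalTwoThree.PrintedSemistableManinFacts)
    (h3 : Summit.BirchSwinnertonDyer.BirchSwinnertonDyer.Theses.ManinLocalTwoThree.ManinPrimeToThreeAtNine) :
    CommutingOrbitDiscrDirection 3 := by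
  obtain ⟨hM, hAU, hC, hnf⟩ := hPF
  exact commutingOrbitDiscrDirection_three_of_maninPrimeToThreeAtNine (h3 hM hAU hC hnf)

/-- The same edge into the REPAIRED leaf of record `CommutingOrbitDiscrDirectionR` at `p = 3`. -/
theorem commutingOrbitDiscrDirectionR_three_of_C3
    (hPF : Summit.BirchSwinnertonDyer.BirchSwinnertonDyer.Theses.ManinLocalTwoThree.PrintedSemistableManinFacts)
    (h3 : Summit.BirchSwinnertonDyer.BirchSwinnertonDyer.Theses.ManinLocalTwoThree.ManinPrimeToThreeAtNine) :
    CommutingOrbitDiscrDirectionR 3 :=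
  fun _ _ ↦ commutingOrbitDiscrDirection_three_of_C3 hPF h3

/-! ### The guarded leaf at every `p`: vacuous off the odd primes, C3 at 3, C5 at `p ≥ 5` (planner g6 addendum,
HOME `an/TwistOrbitDirectionLawRouteEdges-g6.lean` f653ecb37dbae665) -/

/-- Off the odd primes the guarded leaf is vacuously true (so `∀ p, CommutingOrbitDiscrDirectionR p` is the honest
global statement; the unguarded schema is FALSE at `p = 1`, refuter-1 §R31). [folklore] -/
theorem commutingOrbitDiscrDirectionR_of_not_odd_prime {p : ℕ} (h : ¬ p.Prime ∨ p = 2) :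
    CommutingOrbitDiscrDirectionR p := by
  intro hp hp2
  rcases h with h | h
  · exact absurd hp h
  · exact absurd h hp2

/-- **The route's two additive-odd cruxes + the printed facts ⇒ the guarded direction law at EVERY `p`**
(vacuous off the odd primes; C3 at 3; C5 at `p ≥ 5`).  This is the route's typed kill criterion in one line:
`¬ CommutingOrbitDiscrDirectionR p` for a single `p` refutes `PrintedSemistableManinFacts ∧ C3 ∧ C5`
(planner g6; binder order as there). [cite: EdixhovenManin1991, §4 (pp. 12–13)] -/
theorem commutingOrbitDiscrDirectionR_of_C3_C5
    (h3 : Summit.BirchSwinnertonDyer.BirchSwinnertonDyer.Theses.ManinLocalTwoThree.ManinPrimeToThreeAtNine)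
    (h5 : Summit.BirchSwinnertonDyer.BirchSwinnertonDyer.Theses.ManinLocalTwoThree.ManinPrimeToAdditiveFiveLe)
    (hPF : Summit.BirchSwinnertonDyer.BirchSwinnertonDyer.Theses.ManinLocalTwoThree.PrintedSemistableManinFacts)
    (p : ℕ) : CommutingOrbitDiscrDirectionR p := by
  intro hp hp2
  by_cases h3p : p = 3
  · subst h3p
    exact commutingOrbitDiscrDirection_three_of_C3 hPF h3
  · exact commutingOrbitDiscrDirection_of_C5 hPF h5 hp (hp.five_le_of_ne_two_of_ne_three hp2 h3p)

end RouteEdges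

end Summit.BirchSwinnertonDyer.Rank1Residual.ManinAdditive

end
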